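import Literature.AnabelianGeometry.SemiGraphs.TemperedCompletionOpenSubgroups
import Literature.AnabelianGeometry.SemiGraphs.CharacteristicOpenCore
import HarnessLib

/-!
# Profinite completions: a group whose completion is topologically finitely generated has only
# finitely many open subgroups of each finite index ([SemiAnbd] §6 p. 69, Ex. 3.10 p. 44)

Mochizuki, *Semi-graphs of anabelioids*, Publ. RIMS **42** (2006) [SemiAnbd], §6 p. 69 ("natural
injections `Π^temp_{X_K} ↪ Π_{X_K}`", the profinite completion) and Example 3.10 p. 44 ("an exhaustive
sequence of open characteristic [hence normal] subgroups of finite index `… ⊆ N_i ⊆ … ⊆ Δ`")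
[cite: MochizukiSemiAnbd2006, §6 p.69]; the group theory is Dixon–du Sautoy–Mann–Segal, *Analytic pro-p
groups* (2nd ed., 1999), Prop. 1.6 ("a finitely generated profinite group … has only finitely many open
subgroups of index `m`") [cite: DixonEtAl1999, Prop 1.6].

PROOF-ONLY file (abc-iut cell, seat abc-iut-w4-d012 gen 4; no definition, no named fact; Mathlib + two
tree files).  Over the interface `IsProfiniteCompletion ι` (`ι : F → F̂`, abc-iut-L3) we prove:

* `IsProfiniteCompletion.surjective_mk_comp` — for an open normal `V ≤ F̂`, the composite
  `F → F̂ ↠ F̂/V` is SURJECTIVE (dense range meets every coset `g·V`, an open set);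
* (private helper `index_closure_eq_index`) — for an OPEN subgroup `U ≤ F` of FINITE INDEX, the closure `Û` of
  `ι(U)` in `F̂` has the SAME index `[F̂ : Û] = [F : U]` (both equal the index of the image of `Û` in the
  finite quotient `F̂/V`, `V ⊆ Û` open normal, through the two surjections `F ↠ F̂/V`, `F̂ ↠ F̂/V`;
  abc-iut-w5-d139's `comap_topologicalClosure_map`: `ι⁻¹(Û) = U`).  The public statement of this fact is
  abc-iut-L2-t8's `IsProfiniteCompletion.index_topologicalClosure_map` (`EtaleTheta/Discharge/Sec2CompletionIndex`,
  p422750), not imported here so that this SemiGraphs-level file stays free of [EtTh] imports;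
* `IsProfiniteCompletion.finite_setOf_isOpen_index` / `finite_openSubgroupsIndexLE` — if `F̂` is
  TOPOLOGICALLY FINITELY GENERATED then `F` has only finitely many open subgroups of index `n` (resp. of
  index `≤ d`, abc-iut-w4-d053's set `openSubgroupsIndexLE F d`): `U ↦ Û` is injective on them
  (`ι⁻¹(Û) = U`) with values among the open subgroups of `F̂` of the same index, a finite set by
  abc-iut-L5-t6's `IsTopologicallyFinitelyGenerated.finite_setOf_isOpen_index`;
* the `charOpenCore` COROLLARIES BY NAME from abc-iut-w4-d053's `CharacteristicOpenCore.lean` (p429420):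
  `isOpen_charOpenCore_of_completion`, `finiteIndex_charOpenCore_of_completion`,
  `charOpenCore_mem_openSubgroupsIndexLE_of_completion` and the summary
  `charOpenCore_family_of_completion` — `n ↦ charOpenCore F n` is an ANTITONE family of OPEN NORMAL
  FINITE-INDEX subgroups of `F`, FIXED by every bi-continuous automorphism and COFINAL among the open
  finite-index subgroups (`U ⊇ charOpenCore F U.index`).

* (appended) `index_comap_of_isOpen`, `comap_mem_openSubgroupsIndexLE`, `exists_eq_comap_of_mem_openSubgroupsIndexLE`,
  **`comap_charOpenCore`** (`ι⁻¹(charOpenCore F̂ d) = charOpenCore F d` for EVERY profinite completion, no finite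
  generation needed) and `mem_charOpenCore_iff_map_mem`: the characteristic open cores of `F` are the pull-backs of
  those of `F̂` — tempered and profinite characteristic levels of the same depth agree on the tempered group.

USE (abc-iut-L3-lead ruling α39 (1), 2026-08-26T07:06Z; GAP row G-L5t11g6-1; T54·E1b): a group `F` admitting
a profinite completion with topologically finitely generated `F̂` — e.g. `Δ^temp_X ↪ Δ̂_X`, `π₁^temp(𝒢) ↪ π̂₁(𝒢)` for
coherent `𝒢` — carries an "exhaustive sequence of open characteristic subgroups of finite index" ([SemiAnbd]
Ex. 3.10 p. 44) in the COFINAL sense (the field `N_cofinal` wanted by G-L5t11g6-1), and has the finitely many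
open subgroups of each index that abc-iut-L3-t9's `GaloisLevelData.ofGaloisSeq` (p428866) consumes.
Classical; nothing here bears on [IUTchIII] Cor. 3.12; typed ≠ proved elsewhere.
-/

noncomputable section

namespace Literature.AnabelianGeometry.SemiGraphs

namespace IsProfiniteCompletion

open Topology
open Literature.AnabelianGeometry.AbsoluteAnabelian

universe u v

variable {F : Type u} {Fhat : Type v} [Group F] [TopologicalSpace F] [IsTopologicalGroup F]
  [Group Fhat] [TopologicalSpace Fhat] [IsTopologicalGroup Fhat] {ι : F →ₜ* Fhat}

omit [IsTopologicalGroup F] in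
/-- **`F → F̂ ↠ F̂/V` is surjective** for every open normal subgroup `V` of the profinite completion:
each coset `g·V` is an open neighbourhood of `g` and therefore meets the dense image `ι(F)`.
[cite: MochizukiSemiAnbd2006, §6 p.69] -/
theorem surjective_mk_comp (hι : IsProfiniteCompletion ι) (V : OpenNormalSubgroup Fhat) :
    Function.Surjective ((QuotientGroup.mk' V.toSubgroup).comp ι.toMonoidHom) := by
  intro q
  obtain ⟨g, rfl⟩ := QuotientGroup.mk'_surjective V.toSubgroup q
  -- the coset `g·V` is open and contains `g`
  have hopen : IsOpen ((fun v => g * v) '' (V : Set Fhat)) :=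
    (Homeomorph.mulLeft g).isOpenMap _ V.toOpenSubgroup.isOpen
  have hne : ((fun v => g * v) '' (V : Set Fhat)).Nonempty := ⟨g * 1, 1, V.toSubgroup.one_mem, rfl⟩
  obtain ⟨x, hx⟩ := hι.denseRange.exists_mem_open hopen hne
  obtain ⟨v, hv, hvx⟩ := hx
  refine ⟨x, ?_⟩
  rw [MonoidHom.comp_apply, QuotientGroup.mk'_apply, QuotientGroup.mk'_apply, QuotientGroup.eq]
  -- `(ι x)⁻¹ * g = v⁻¹ ∈ V`
  have : (ι.toMonoidHom x : Fhat) = g * v := by simpa using hvx.symm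
  rw [this, mul_inv_rev, mul_assoc, inv_mul_cancel, mul_one]
  exact V.toSubgroup.inv_mem hv

/-- **The closure of the image of an open finite-index subgroup has the same index** (local helper; the
public statement is abc-iut-L2-t8's `IsProfiniteCompletion.index_topologicalClosure_map`, p422750):
`[F̂ : Û] = [F : U]` for `Û := cl ι(U)`, `U ≤ F` open of finite index.  Both indices equal the index of
`Û/V` in the finite group `F̂/V` for an open normal `V ⊆ Û` (abc-iut-w5-d139's `exists_openNormal_le`),
via the surjections `F ↠ F̂/V` (`surjective_mk_comp`) and `F̂ ↠ F̂/V`, since `ι⁻¹(Û) = U`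
(`comap_topologicalClosure_map`). [cite: DixonEtAl1999, Prop 1.6] -/
private theorem index_closure_eq_index (hι : IsProfiniteCompletion ι) (U : Subgroup F)
    (hU : IsOpen (U : Set F)) [U.FiniteIndex] :
    ((U.map ι.toMonoidHom).topologicalClosure).index = U.index := by
  set W : Subgroup Fhat := (U.map ι.toMonoidHom).topologicalClosure with hWdef
  obtain ⟨V, -, hV⟩ := exists_openNormal_le hι U hU
  -- `V ≤ W`
  have hVW : V.toSubgroup ≤ W := by
    intro z hz
    have hz' : z ∈ closure (ι '' (U : Set F)) := hV hz
    rw [hWdef, ← SetLike.mem_coe, Subgroup.topologicalClosure_coe, Subgroup.coe_map]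
    exact hz'
  -- `W` is the preimage of its image `W̄ ≤ F̂/V`
  set π : Fhat →* Fhat ⧸ V.toSubgroup := QuotientGroup.mk' V.toSubgroup with hπdef
  have hker : π.ker ≤ W := by rw [hπdef, QuotientGroup.ker_mk']; exact hVW
  have hWπ : (W.map π).comap π = W := Subgroup.comap_map_eq_self hker
  -- index of `W` = index of `W̄` (π surjective)
  have h1 : W.index = (W.map π).index := by
    conv_lhs => rw [← hWπ]
    exact Subgroup.index_comap_of_surjective _ (QuotientGroup.mk'_surjective _)
  -- index of `U` = index of `W̄` (π ∘ ι surjective and `ι⁻¹ W = U`)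
  have hU' : U = ((W.map π).comap π).comap ι.toMonoidHom := by
    rw [hWπ, hWdef]
    exact (comap_topologicalClosure_map hι U hU).symm
  have h2 : U.index = (W.map π).index := by
    rw [hU', Subgroup.comap_comap]
    exact Subgroup.index_comap_of_surjective _ (surjective_mk_comp hι V)
  rw [h1, ← h2]

/-- **A group whose profinite completion is topologically finitely generated has only finitely many
open subgroups of each finite index `n`.** The map `U ↦ cl ι(U)` is injective on open finite-index
subgroups (`ι⁻¹(cl ι(U)) = U`, abc-iut-w5-d139) and takes values in the open subgroups of `F̂` of index `n`
(`index_closure_eq_index`, `isOpen_topologicalClosure_map`), a finite set (abc-iut-L5-t6's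
`IsTopologicallyFinitelyGenerated.finite_setOf_isOpen_index`). [cite: DixonEtAl1999, Prop 1.6] -/
theorem finite_setOf_isOpen_index (hι : IsProfiniteCompletion ι)
    (hfg : IsTopologicallyFinitelyGenerated Fhat) {n : ℕ} (hn : n ≠ 0) :
    {U : Subgroup F | IsOpen (U : Set F) ∧ U.index = n}.Finite := by
  haveI : CompactSpace Fhat := hι.compactSpace
  let cl : Subgroup F → Subgroup Fhat := fun U => (U.map ι.toMonoidHom).topologicalClosure
  have hfinT : {W : Subgroup Fhat | IsOpen (W : Set Fhat) ∧ W.index = n}.Finite :=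
    hfg.finite_setOf_isOpen_index hn
  refine Set.Finite.of_finite_image (f := cl) (hfinT.subset ?_) ?_
  · -- the image lands in the open subgroups of `F̂` of index `n`
    rintro _ ⟨U, ⟨hUo, hUn⟩, rfl⟩
    haveI : U.FiniteIndex := ⟨by rw [hUn]; exact hn⟩
    exact ⟨isOpen_topologicalClosure_map hι U hUo, (index_closure_eq_index hι U hUo).trans hUn⟩
  · -- injectivity: `ι⁻¹(cl ι(U)) = U`
    rintro U ⟨hUo, hUn⟩ U' ⟨hU'o, hU'n⟩ hUU'
    haveI : U.FiniteIndex := ⟨by rw [hUn]; exact hn⟩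
    haveI : U'.FiniteIndex := ⟨by rw [hU'n]; exact hn⟩
    have h := comap_topologicalClosure_map hι U hUo
    have h' := comap_topologicalClosure_map hι U' hU'o
    have hc : (cl U).comap ι.toMonoidHom = (cl U').comap ι.toMonoidHom := by
      show ((U.map ι.toMonoidHom).topologicalClosure).comap ι.toMonoidHom =
        ((U'.map ι.toMonoidHom).topologicalClosure).comap ι.toMonoidHom
      exact congrArg (fun W : Subgroup Fhat => W.comap ι.toMonoidHom) hUU'
    rw [h, h'] at hc
    exact hc

/-- **Bounded form**: only finitely many open subgroups of index `≤ d` — abc-iut-w4-d053's set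
`openSubgroupsIndexLE F d = {U | IsOpen U ∧ 0 < U.index ∧ U.index ≤ d}` is FINITE (the finiteness hypothesis
of `isOpen_charOpenCore` / `charOpenCore_index_ne_zero`). [cite: DixonEtAl1999, Prop 1.6] -/
theorem finite_openSubgroupsIndexLE (hι : IsProfiniteCompletion ι)
    (hfg : IsTopologicallyFinitelyGenerated Fhat) (d : ℕ) : (openSubgroupsIndexLE F d).Finite := by
  have h : openSubgroupsIndexLE F d ⊆
      ⋃ n ∈ Finset.Icc 1 d, {U : Subgroup F | IsOpen (U : Set F) ∧ U.index = n} := by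
    rintro U ⟨hUo, hU0, hUd⟩
    refine Set.mem_biUnion (x := U.index) ?_ ⟨hUo, rfl⟩
    exact Finset.mem_Icc.mpr ⟨hU0, hUd⟩
  refine Set.Finite.subset ?_ h
  exact (Finset.Icc 1 d).finite_toSet.biUnion fun n hn =>
    finite_setOf_isOpen_index hι hfg (Nat.pos_iff_ne_zero.mp (Finset.mem_Icc.mp hn).1)

/-! ### The characteristic open cores of a group with topologically finitely generated completion -/

/-- In a group admitting a profinite completion with topologically finitely generated `F̂`, every
characteristic open core `charOpenCore F d` is OPEN (abc-iut-w4-d053's `isOpen_charOpenCore` fed with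
`finite_openSubgroupsIndexLE`). [cite: DixonEtAl1999, Prop 1.6] -/
theorem isOpen_charOpenCore_of_completion (hι : IsProfiniteCompletion ι)
    (hfg : IsTopologicallyFinitelyGenerated Fhat) (d : ℕ) : IsOpen (charOpenCore F d : Set F) :=
  isOpen_charOpenCore (finite_openSubgroupsIndexLE hι hfg d)

/-- … and has FINITE INDEX (`charOpenCore_index_ne_zero`). [cite: DixonEtAl1999, Prop 1.6] -/
theorem finiteIndex_charOpenCore_of_completion (hι : IsProfiniteCompletion ι)
    (hfg : IsTopologicallyFinitelyGenerated Fhat) (d : ℕ) : (charOpenCore F d).FiniteIndex :=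
  Subgroup.finiteIndex_iff.mpr (charOpenCore_index_ne_zero (finite_openSubgroupsIndexLE hι hfg d))

/-- … so it is itself one of the open subgroups of index `≤` its own index
(`charOpenCore_mem_openSubgroupsIndexLE`). [cite: DixonEtAl1999, Prop 1.6] -/
theorem charOpenCore_mem_openSubgroupsIndexLE_of_completion (hι : IsProfiniteCompletion ι)
    (hfg : IsTopologicallyFinitelyGenerated Fhat) (d : ℕ) :
    charOpenCore F d ∈ openSubgroupsIndexLE F (charOpenCore F d).index :=
  charOpenCore_mem_openSubgroupsIndexLE (finite_openSubgroupsIndexLE hι hfg d)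

/-- **Summary — the cofinal characteristic family of a group with topologically finitely generated
profinite completion** ([SemiAnbd] Ex. 3.10 p. 44 "an exhaustive sequence of open characteristic [hence
normal] subgroups of finite index", in the COFINAL sense): `n ↦ charOpenCore F n` is ANTITONE, each member
is OPEN, NORMAL, of FINITE INDEX and FIXED by every bi-continuous automorphism of `F`, and every open
subgroup of finite index contains one of them (`U ⊇ charOpenCore F U.index`).  The automorphism-stability,
normality, antitonicity and cofinality are abc-iut-w4-d053's (`map_charOpenCore_eq`, `charOpenCore_normal`,
`charOpenCore_anti`, `charOpenCore_le_of_finiteIndex`); openness and finite index are supplied here through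
the completion. [cite: MochizukiSemiAnbd2006, Ex 3.10 p.44] -/
theorem charOpenCore_family_of_completion (hι : IsProfiniteCompletion ι)
    (hfg : IsTopologicallyFinitelyGenerated Fhat) :
    Antitone (charOpenCore F) ∧
      (∀ n, IsOpen (charOpenCore F n : Set F) ∧ (charOpenCore F n).Normal ∧
        (charOpenCore F n).FiniteIndex ∧
        ∀ φ : MulAut F, Continuous φ → Continuous φ.symm →
          (charOpenCore F n).map φ.toMonoidHom = charOpenCore F n) ∧
      ∀ U : Subgroup F, IsOpen (U : Set F) → U.FiniteIndex → ∃ n, charOpenCore F n ≤ U :=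
  ⟨fun _ _ h => charOpenCore_anti h,
    fun n => ⟨isOpen_charOpenCore_of_completion hι hfg n, charOpenCore_normal n,
      finiteIndex_charOpenCore_of_completion hι hfg n, fun φ hφ hφ' => map_charOpenCore_eq φ hφ hφ'⟩,
    fun U hU _ => ⟨U.index, charOpenCore_le_of_finiteIndex U hU⟩⟩

/-! ### The characteristic open cores of `F` are the pull-backs of those of `F̂` (appended 2026-08-26) -/

omit [IsTopologicalGroup F] in
/-- **Indices of OPEN subgroups survive pull-back along a profinite completion**: for an open subgroup
`W ≤ F̂`, `[F : ι⁻¹(W)] = [F̂ : W]` — both equal the index of `W/V` in the finite group `F̂/V` for an open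
normal `V ≤ W` (Mathlib `exist_openNormalSubgroup_sub_open_nhds_of_one`, `F̂` profinite), through the two
surjections `F̂ ↠ F̂/V` and `F ↠ F̂/V` (`surjective_mk_comp`). No finite generation needed.
[cite: MochizukiSemiAnbd2006, §6 p.69] -/
theorem index_comap_of_isOpen (hι : IsProfiniteCompletion ι) (W : Subgroup Fhat)
    (hW : IsOpen (W : Set Fhat)) : (W.comap ι.toMonoidHom).index = W.index := by
  haveI : CompactSpace Fhat := hι.compactSpace
  haveI : TotallyDisconnectedSpace Fhat := hι.totallyDisconnectedSpace
  obtain ⟨V, hV⟩ := ProfiniteGrp.exist_openNormalSubgroup_sub_open_nhds_of_one hW W.one_mem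
  have hVW : V.toSubgroup ≤ W := fun z hz => hV hz
  set π : Fhat →* Fhat ⧸ V.toSubgroup := QuotientGroup.mk' V.toSubgroup with hπdef
  have hker : π.ker ≤ W := by rw [hπdef, QuotientGroup.ker_mk']; exact hVW
  have hWπ : (W.map π).comap π = W := Subgroup.comap_map_eq_self hker
  have h1 : W.index = (W.map π).index := by
    conv_lhs => rw [← hWπ]
    exact Subgroup.index_comap_of_surjective _ (QuotientGroup.mk'_surjective _)
  have h2 : (W.comap ι.toMonoidHom).index = (W.map π).index := by
    conv_lhs => rw [← hWπ]
    rw [Subgroup.comap_comap]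
    exact Subgroup.index_comap_of_surjective _ (surjective_mk_comp hι V)
  rw [h2, h1]

omit [IsTopologicalGroup F] in
/-- `ι⁻¹` carries the open subgroups of `F̂` of index `≤ d` INTO those of `F` (continuity of `ι` and
`index_comap_of_isOpen`). [cite: DixonEtAl1999, Prop 1.6] -/
theorem comap_mem_openSubgroupsIndexLE (hι : IsProfiniteCompletion ι) {d : ℕ} {W : Subgroup Fhat}
    (hW : W ∈ openSubgroupsIndexLE Fhat d) : W.comap ι.toMonoidHom ∈ openSubgroupsIndexLE F d := by
  refine ⟨?_, ?_, ?_⟩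
  · rw [Subgroup.coe_comap]; exact hW.1.preimage ι.continuous_toFun
  · rw [index_comap_of_isOpen hι W hW.1]; exact hW.2.1
  · rw [index_comap_of_isOpen hι W hW.1]; exact hW.2.2

/-- … and ONTO them: every open subgroup `U ≤ F` of index `≤ d` is `ι⁻¹(Û)` for the open subgroup
`Û := cl ι(U) ≤ F̂` of the same index (abc-iut-w5-d139's `comap_topologicalClosure_map`,
`isOpen_topologicalClosure_map`; `index_closure_eq_index`). [cite: DixonEtAl1999, Prop 1.6] -/
theorem exists_eq_comap_of_mem_openSubgroupsIndexLE (hι : IsProfiniteCompletion ι) {d : ℕ}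
    {U : Subgroup F} (hU : U ∈ openSubgroupsIndexLE F d) :
    ∃ W ∈ openSubgroupsIndexLE Fhat d, W.comap ι.toMonoidHom = U := by
  haveI : U.FiniteIndex := ⟨hU.2.1.ne'⟩
  refine ⟨(U.map ι.toMonoidHom).topologicalClosure, ⟨isOpen_topologicalClosure_map hι U hU.1, ?_, ?_⟩,
    comap_topologicalClosure_map hι U hU.1⟩
  · rw [index_closure_eq_index hι U hU.1]; exact hU.2.1
  · rw [index_closure_eq_index hι U hU.1]; exact hU.2.2

/-- **The characteristic open cores of a group are the pull-backs of those of its profinite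
completion**: `ι⁻¹(charOpenCore F̂ d) = charOpenCore F d` for EVERY profinite completion `ι : F → F̂`
(no finite-generation hypothesis) — the open subgroups of index `≤ d` on the two sides correspond under
`ι⁻¹` (`comap_mem_openSubgroupsIndexLE`, `exists_eq_comap_of_mem_openSubgroupsIndexLE`) and `ι⁻¹`
commutes with intersections.  So the cofinal characteristic family of a tempered group (`Δ^temp_X`,
`Π^±_v`, …) is the RESTRICTION of that of its completion (`Δ̂_X`, `Π̂^±_v`, …): tempered and profinite
characteristic levels of the same depth cut out the same subgroup of the tempered group.
[cite: MochizukiSemiAnbd2006, §6 p.69] -/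
theorem comap_charOpenCore (hι : IsProfiniteCompletion ι) (d : ℕ) :
    (charOpenCore Fhat d).comap ι.toMonoidHom = charOpenCore F d := by
  apply le_antisymm
  · rw [le_charOpenCore_iff]
    intro U hU
    obtain ⟨W, hW, rfl⟩ := exists_eq_comap_of_mem_openSubgroupsIndexLE hι hU
    exact Subgroup.comap_mono (charOpenCore_le hW)
  · intro x hx
    rw [Subgroup.mem_comap, charOpenCore, Subgroup.mem_sInf]
    intro W hW
    exact charOpenCore_le (comap_mem_openSubgroupsIndexLE hι hW) hx

/-- Membership form: `x ∈ charOpenCore F d ↔ ι x ∈ charOpenCore F̂ d`. [cite: MochizukiSemiAnbd2006, §6 p.69] -/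
theorem mem_charOpenCore_iff_map_mem (hι : IsProfiniteCompletion ι) (d : ℕ) (x : F) :
    x ∈ charOpenCore F d ↔ ι x ∈ charOpenCore Fhat d := by
  rw [← comap_charOpenCore hι d, Subgroup.mem_comap]
  rfl

end IsProfiniteCompletion

end Literature.AnabelianGeometry.SemiGraphs

end
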